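import Literature.NumberTheory.EllipticCurves.YanZhu2026.GreenbergMainTheoremsAnyRoot
import Literature.NumberTheory.EllipticCurves.BurungaleCastellaSkinner2025.BDPMainConjecture
import Literature.NumberTheory.EllipticCurves.Rubin1991.TwoVariableCMLines
import Literature.NumberTheory.EllipticCurves.AnticyclotomicRankinSelbergPAdicLFunction
import HarnessLib

/-!
# Burungale–Castella–Skinner 2025, Proposition 4.2.2 — the `L_p^Gr` half `μ(L_p^Gr(E/K)) = 0`,
# PROVED from the typed `L_p^BDP` half and the anticyclotomic comparison (PROOFS only)

`Proofs` companion (theorems only: no definition, no named fact, no instance) of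
`BDPMainConjecture.lean` (this directory; typing layer D-0088(4), seat `bsd-littype-03`, gen 4) and
of `YanZhu2026/GreenbergMainTheorems.lean` (seat `bsd-littype-04`, gen 3: the carrier
`IsGreenbergLFunction₂` of the two-variable Greenberg `p`-adic `L`-function
`𝓛_p^Gr(f/K) = h_K · 𝓛_𝔭(K)' · 𝓛_p^II(f/K) ∈ Λ_K^ur`, [CGS25, Def. 2.4.3] = [YZ26, Def. 3.11]).

A. Burungale, F. Castella, C. Skinner, *Base change and Iwasawa main conjectures for GL₂*, IMRN
2025 rnaf082 = arXiv:2405.00270v2, **Proposition 4.2.2** (§4.2, pp. 8–9,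
`[corpus: paper:arxiv-2405.00270 p0009 L2–L13]`), verbatim:

> **Proposition 4.2.2.** Let `g ∈ S₂(Γ₀(N))` be an elliptic newform with good reduction at `p > 2`,
> and suppose `K` is an imaginary quadratic field satisfying (disc), (Heeg), (spl), and (irr_K).
> Then `μ(L_p^Gr(g/K)) = μ(L_p^BDP(g/K)) = 0`.
> *Proof.* By [Hsi14, Thm. B], `L_p^BDP(g/K)` has vanishing `μ`-invariant. Since a direct comparison
> of the interpolation properties shows that the projection of `L_p^Gr(g/K)` to `Λ_K^{−,ur}`
> generates the same ideal as `L_p^BDP(g/K)` (see [CGS23, Prop. 1.4.5]), the result follows. □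

`BDPMainConjecture.lean` TYPED the `L_p^BDP` half as the named fact
`prop422_exists_isBDPLFunction_mu_eq_zero` (conclusion: SOME coefficient of `L_p^BDP ∈ R₀⟦T⟧` is a
unit of `R₀`) and recorded the `L_p^Gr` half as "NOT typed (no tree object)".  The tree now has the
object (`IsGreenbergLFunction₂`, in the orientation of `Rubin1991/TwoVariableMainConjecture.lean`:
analytic frames read at the INVERSE generators `(γ₁⁻¹, γ₂⁻¹)`) and the comparison
"[CGS23, Prop. 1.4.5]" = [CGS25, Prop. 2.4.5] = [YZ26, Prop. 3.14] as the named fact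
`YanZhu2026.prop314_span_minus_eq_span_bdp` (`(𝓛^Gr⁻) = (L_p^BDP)` as ideals of `𝒪_{ℂ_p}⟦T⟧`, for
EVERY Katz/Greenberg frame and EVERY BDP frame at `γ₂⁻¹`).  THIS FILE REPLAYS THE PRINTED PROOF in
the kernel:

* `hasUnitContent_minus_of_prop314_of_prop422` — granted those two named facts, under the
  Greenberg standing data (`YanZhu2026.GreenbergSetting`: `p > 2` good ordinary split in `K`,
  `(N, D_K) = 1`, (disc), `(κ₁, κ₂)` = (cyclotomic, anticyclotomic)), (Heeg) and (irr_K), EVERY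
  Katz/Greenberg frame `(LK, G)` of `f_E` has `μ(G⁻) = 0`: some coefficient of the anticyclotomic
  projection `G⁻ = UnrSeries₂.minus G` is a unit of `𝒪_{ℂ_p}` (`GreenbergVatsal2000.HasUnitContent`);
* `exists_isUnit_coeff_coeff_of_prop314_of_prop422` — hence **`μ(L_p^Gr(E/K)) = 0`** in the
  two-variable sense: some coefficient `[T₁⁰ T₂ʲ] G` of `G ∈ 𝒪_{ℂ_p}⟦T₁⟧⟦T₂⟧` is a unit (a series all of
  whose coefficients lie in the maximal ideal has no such coefficient).

The steps (all proved here): (i) the BDP frame of `prop422_…` lives at a topological generator `γ` of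
an anticyclotomic `κ`; the comparison fact reads BDP frames at `γ₂⁻¹`, which generates the unit twist
`κ₂^{(−1)}` (`isTopGenerator_unitTwist_neg_one_inv`), still anticyclotomic
(`isAnticyclotomic_unitTwist`), and `IsBDPLFunction` sees `κ` only through `ker κ`
(`isBDPLFunction_unitTwist_iff`); (ii) a ring map `J₀ : R₀ → 𝒪_{ℂ_p}` compatible with the two
inclusions into `ℂ_p` exists (`exists_ringHom_unrIntegers_padicComplexInt`, from the tree's
`unrIntegers_le_padicComplexInt`) and maps unit coefficients to unit coefficients; (iii) equal
principal ideals of the domain `𝒪_{ℂ_p}⟦T⟧` have associated generators (Mathlib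
`Ideal.span_singleton_eq_span_singleton`), and a unit factor does not change unit content over the
local ring `𝒪_{ℂ_p}` (`hasUnitContent_mul_iff_of_isUnit`, `Rubin1991/TwoVariableCMLines.lean`).

HONEST SCOPE.  The theorems are implications from the two named facts; they hold for the newform
`f = f_E` of an elliptic curve (the facts' currency) at an odd good ORDINARY prime (the standing data
of the Greenberg carrier) — WEAKER than the printed "good reduction at `p > 2`" (special case).
Nothing is asserted about Hsieh's theorem or the comparison beyond what the two facts state.

## References
* [BurungaleCastellaSkinner2025] IMRN 2025 rnaf082 = arXiv:2405.00270v2, Prop. 4.2.2 and its proof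
  (§4.2, pp. 8–9).
* [YanZhu2024MainConjNonCM] J. Algebra 693 (2026) = arXiv:2412.20078v4, Def. 3.11, Prop. 3.14
  (= [CastellaGrossiSkinner2025] Math. Ann. 393, Def. 2.4.3, Prop. 2.4.5).
* [Hsieh2014] M.-L. Hsieh, Doc. Math. 19 (2014), Thm. B (the source of `μ(L_p^BDP) = 0`).
* [GreenbergVatsal2000] R. Greenberg, V. Vatsal, Invent. Math. 142 (2000), p. 2 (1)–(2) (`μ = 0` ⟺
  some coefficient is a unit).

## v2 (same seat, 2026-08-27): the transfer over the SOUND value frame (§D)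
The §C theorems are stated over `YanZhu2026.IsGreenbergLFunction₂` and the comparison fact
`prop314_span_minus_eq_span_bdp`, whose value frame reads `L(f/K, ξ, 1)` through
`rankinSelbergValueHecke` — junk `0` on the non-unitary half of the type-II range, so that no series
satisfies it (seat `bsd-littype-02`, cell INBOX 2026-08-27T01:24:27Z): §C is TRUE but VACUOUS.  §D
re-runs the same printed argument over the superseding facts of
`YanZhu2026/GreenbergMainTheoremsAnyRoot.lean` (seat `bsd-littype-04` gen 4): the sound,
reduction-type-free frame `IsGreenbergLFunctionAnyRoot₂` and `prop314_span_minus_eq_span_bdp_anyRoot`,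
whose BDP frame sits at the PLAIN anticyclotomic generator `γ₂` ((D2) there) — so Hsieh's frame of
`prop422_…` is taken at `γ₂` directly and the unit-twist detour of §C is not needed:
`hasUnitContent_minus_of_prop314AnyRoot_of_prop422`, `exists_isUnit_coeff_coeff_of_prop314AnyRoot_of_prop422`,
`prop422_both_of_thm39AnyRoot_of_prop314AnyRoot_of_prop422`.
-/

noncomputable section

open scoped Classical

open PowerSeries NumberField IsDedekindDomain Field CongruenceSubgroup
  Literature.NumberTheory.GaloisRepresentations Literature.NumberTheory.EllipticCurves
  Literature.NumberTheory.EllipticCurves.ModularForms Literature.NumberTheory.EllipticCurves.Rank1Residual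
  Literature.NumberTheory.EllipticCurves.GreenbergVatsal2000
  Literature.NumberTheory.EllipticCurves.UnrSeries₂

universe u

/-! ## §A. Unit twists of a `ℤ_p`-extension: inverse generators, anticyclotomicity, BDP frames -/

namespace Literature.NumberTheory.EllipticCurves

section UnitTwist

variable {K : Type} [Field K] [NumberField K] {p : ℕ} [Fact p.Prime]

omit [NumberField K] in
/-- `γ⁻¹` is a topological generator of the unit twist `κ^{(−1)}` of `κ` whenever `γ` is one of `κ`
(`κ^{(−1)}(γ⁻¹) = (−1)·(−1) = 1`). [cite: deShalit1987, II.4.17 (54) (p. 78)] -/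
theorem ZpExtension.isTopGenerator_unitTwist_neg_one_inv {κ : ZpExtension K p}
    {γ : absoluteGaloisGroup K} (hγ : κ.IsTopGenerator γ) : (κ.unitTwist (-1)).IsTopGenerator γ⁻¹ := by
  rw [ZpExtension.IsTopGenerator] at hγ ⊢
  rw [ZpExtension.unitTwist_apply, map_inv, hγ]
  simp

/-- A unit twist of an anticyclotomic `ℤ_p`-extension is anticyclotomic (complex conjugation still
acts by inversion: `u·(−x) = −(u·x)`). [cite: YanZhu2024MainConjNonCM, §2 ("Γ_K ≅ Γ_K⁺ × Γ_K⁻", arXiv:2412.20078v4 TeX l.444–450)] -/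
theorem ZpExtension.isAnticyclotomic_unitTwist {κ : ZpExtension K p} (hκ : κ.IsAnticyclotomic)
    (u : ℤ_[p]ˣ) : (κ.unitTwist u).IsAnticyclotomic := by
  intro σ τ ρ hρ hconj
  have h := hκ σ τ ρ hρ hconj
  rw [ZpExtension.unitTwist_apply, ZpExtension.unitTwist_apply, h, toAdd_inv, mul_neg, ofAdd_neg]

omit [NumberField K] in
/-- `FactorsThroughZp` sees `κ` only through `ker κ`, which a unit twist does not change.
[cite: Castella2018, §2.2 and §3 (Λ = ℤ_p⟦Γ⟧, 1 + T ↔ γ)] -/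
theorem factorsThroughZp_unitTwist_iff {A : Type*} [CommRing A] [TopologicalSpace A]
    (κ : ZpExtension K p) (u : ℤ_[p]ˣ) (r : FramedGaloisRep K A 1) :
    FactorsThroughZp (κ.unitTwist u) r ↔ FactorsThroughZp κ r := by
  have h1 : ∀ σ : absoluteGaloisGroup K, (κ.unitTwist u) σ = 1 ↔ κ σ = 1 := fun σ ↦ by
    rw [← ZpExtension.mem_kerSubgroup, ← ZpExtension.mem_kerSubgroup, ZpExtension.kerSubgroup_unitTwist]
  simp only [FactorsThroughZp, h1]

/-- **The BDP interpolation frame is insensitive to unit twists of `κ`** (it reads `κ` only through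
`FactorsThroughZp κ`): `IsBDPLFunction ι 𝔭 κ^{(u)} γ f Ω_K Ω_p L ↔ IsBDPLFunction ι 𝔭 κ γ f Ω_K Ω_p L`.
[cite: Castella2018, Thm. 3.1 (the normalisation `IsBDPLFunction`)] -/
theorem isBDPLFunction_unitTwist_iff (ι : PadicAlgCl p ≃+* ℂ) (𝔭 : HeightOneSpectrum (𝓞 K))
    (κ : ZpExtension K p) (u : ℤ_[p]ˣ) (γ : absoluteGaloisGroup K) {N : ℕ}
    (f : CuspForm (Gamma0 N) 2) (ΩK : ℂ) (Ωp : ℂ_[p]) (L : UnrSeries p) :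
    IsBDPLFunction ι 𝔭 (κ.unitTwist u) γ f ΩK Ωp L ↔ IsBDPLFunction ι 𝔭 κ γ f ΩK Ωp L := by
  simp only [IsBDPLFunction, factorsThroughZp_unitTwist_iff]

end UnitTwist

/-! ## §B. `R₀ → 𝒪_{ℂ_p}` and unit content along it -/

section Inclusion

variable {p : ℕ} [Fact p.Prime]

/-- **A ring map `J₀ : R₀ → 𝒪_{ℂ_p}` compatible with the inclusions into `ℂ_p`** (the structure map
along which the BDP comparison fact `prop314_…` is read): `R₀ = unrIntegers p ⊆ 𝒪_{ℂ_p}`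
(`unrIntegers_le_padicComplexInt`). [cite: Castella2018, §3 (R₀ ⊂ ℂ_p, arXiv:1704.06608 p. 9)] -/
theorem exists_ringHom_unrIntegers_padicComplexInt :
    ∃ J₀ : unrIntegers p →+* PadicComplexInt p,
      ∀ x : unrIntegers p, ((J₀ x : PadicComplexInt p) : ℂ_[p]) = (x : ℂ_[p]) := by
  refine ⟨{ toFun := fun x ↦ ⟨(x : ℂ_[p]), unrIntegers_le_padicComplexInt x.2⟩
            map_one' := Subtype.ext rfl
            map_mul' := fun _ _ ↦ Subtype.ext rfl
            map_zero' := Subtype.ext rfl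
            map_add' := fun _ _ ↦ Subtype.ext rfl }, fun x ↦ rfl⟩

/-- A ring map carries a series with a unit coefficient to one (`[Tᵏ](map J L) = J([Tᵏ]L)`).
[cite: GreenbergVatsal2000, p. 2, (1)–(2)] -/
theorem GreenbergVatsal2000.HasUnitContent.map {R S : Type*} [CommSemiring R] [CommSemiring S]
    (J : R →+* S) {L : PowerSeries R} (h : HasUnitContent L) : HasUnitContent (PowerSeries.map J L) := by
  obtain ⟨k, hk⟩ := h
  exact ⟨k, by rw [PowerSeries.coeff_map]; exact hk.map J⟩

/-- **Equal principal ideals of `𝒪_{ℂ_p}⟦T⟧` carry the same unit-content verdict** (the step "generates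
the same ideal as `L_p^BDP(g/K)` … the result follows" of BCS's proof): the generators are associated
(`𝒪_{ℂ_p}⟦T⟧` is a domain) and a unit factor does not change unit content over the local ring
`𝒪_{ℂ_p}`. [cite: BurungaleCastellaSkinner2025, proof of Prop. 4.2.2 (§4.2, p. 9 of arXiv:2405.00270v2)]
[cite: GreenbergVatsal2000, p. 2, (2)] -/
theorem GreenbergVatsal2000.HasUnitContent.of_span_singleton_eq {a b : PowerSeries (PadicComplexInt p)}
    (hab : Ideal.span {a} = Ideal.span {b}) (hb : HasUnitContent b) : HasUnitContent a := by
  obtain ⟨u, hu⟩ := Ideal.span_singleton_eq_span_singleton.mp hab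
  -- `a * u = b`, so `b = u * a`
  rw [← hu, mul_comm] at hb
  exact (hasUnitContent_mul_iff_of_isUnit u.isUnit a).mp hb

end Inclusion

end Literature.NumberTheory.EllipticCurves

/-! ## §C. Proposition 4.2.2, the `L_p^Gr` half — PROVED from the two named facts -/

namespace Literature.NumberTheory.EllipticCurves.BurungaleCastellaSkinner2025

open YanZhu2026

variable {p : ℕ} [Fact p.Prime]

/-- **BCS 2025, Prop. 4.2.2, `L_p^Gr` half, anticyclotomic projection: `μ(L_p^Gr(E/K)⁻) = 0`** —
the printed proof replayed: "By [Hsi14, Thm. B], `L_p^BDP(g/K)` has vanishing `μ`-invariant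
[`prop422_exists_isBDPLFunction_mu_eq_zero`]. Since … the projection of `L_p^Gr(g/K)` to `Λ_K^{−,ur}`
generates the same ideal as `L_p^BDP(g/K)` [`YanZhu2026.prop314_span_minus_eq_span_bdp` =
CGS Prop. 2.4.5], the result follows."  Granted those two named facts: for `E = W/ℚ` elliptic and
globally minimal with newform `f`, under `GreenbergSetting ι W N K 𝔭 𝔭̄ κ₁ κ₂` (`p > 2` good ordinary
split, `(N, D_K) = 1`, (disc), `(κ₁, κ₂)` = (cyc, anticyc)), (Heeg) and (irr_K), EVERY Katz/Greenberg
frame `(LK, G)` at an adapted generator pair `(γ₁, γ₂)` (read at `(γ₁⁻¹, γ₂⁻¹)`) has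
`HasUnitContent (G⁻)`: some coefficient of `G⁻ = G(0, T₂) ∈ 𝒪_{ℂ_p}⟦T₂⟧` is a unit.  WEAKER than print
(ordinary `p`; `f = f_E`). [cite: BurungaleCastellaSkinner2025, Prop. 4.2.2 and its proof (§4.2, pp. 8–9 of arXiv:2405.00270v2)]
[cite: YanZhu2024MainConjNonCM, Prop. 3.14 (arXiv:2412.20078v4 TeX l.896–903)] [cite: Hsieh2014, Thm. B] -/
theorem hasUnitContent_minus_of_prop314_of_prop422 (h314 : prop314_span_minus_eq_span_bdp)
    (h422 : prop422_exists_isBDPLFunction_mu_eq_zero) (ι : PadicAlgCl p ≃+* ℂ)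
    (W : WeierstrassCurve ℚ) [W.IsElliptic] [W.IsGloballyMinimal] (K : Type) [Field K] [NumberField K]
    (v vbar : HeightOneSpectrum (𝓞 K)) (κ₁ κ₂ : ZpExtension K p) (γ₁ γ₂ : absoluteGaloisGroup K)
    [hpair : Fact (ZpExtension.IsTopGeneratorPair κ₁ κ₂ γ₁ γ₂)] {N : ℕ} [NeZero N]
    {f : CuspForm (Gamma0 N) 2} (hf : IsNewformOf W f) [NeZero (NumberField.discr K).natAbs]
    (hS : GreenbergSetting ι W N K v vbar κ₁ κ₂) (hHeeg : SatisfiesHeegnerHypothesis N K)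
    (hirrK : (W.baseChange K).HasIrreducibleModPGaloisRep p) {Ω δ : ℂ} {Ωp : (unrIntegers p)ˣ}
    {LK G : PowerSeries (PowerSeries (PadicComplexInt p))}
    (hLK : IsKatzMeasure₂ ι v vbar ∅ κ₁ κ₂ γ₁⁻¹ γ₂⁻¹ 1 Ω δ ((Ωp : unrIntegers p) : ℂ_[p]) LK)
    (hG : IsGreenbergLFunction₂ ι v vbar κ₁ κ₂ γ₁⁻¹ γ₂⁻¹ f (NumberField.discr K).natAbs
      (NumberField.classNumber K) LK G) :
    HasUnitContent (minus G) := by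
  -- (i) Hsieh's `μ(L_p^BDP) = 0` frame, at the generator `γ₂⁻¹` of the unit twist `κ₂^{(−1)}`
  have hgen : (κ₂.unitTwist (-1)).IsTopGenerator γ₂⁻¹ :=
    ZpExtension.isTopGenerator_unitTwist_neg_one_inv hpair.out.right
  have hanti : (κ₂.unitTwist (-1)).IsAnticyclotomic :=
    ZpExtension.isAnticyclotomic_unitTwist hS.anticyclotomic (-1)
  obtain ⟨ΩK, Ωp', L, hΩK, hBDP', k, hk⟩ := h422 ι W K v (κ₂.unitTwist (-1)) γ₂⁻¹ hf
    (by have := hS.three_le; omega) hS.goodOrd.1 hS.isImaginaryQuadratic hHeeg hS.split hS.discr_odd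
    hS.discr_ne hirrK hS.mem_v hS.compat hanti hgen
  have hBDP : IsBDPLFunction ι v κ₂ γ₂⁻¹ f ΩK ((Ωp' : unrIntegers p) : ℂ_[p]) L :=
    (isBDPLFunction_unitTwist_iff ι v κ₂ (-1) γ₂⁻¹ f ΩK _ L).mp hBDP'
  -- (ii) the structure map `J₀ : R₀ → 𝒪_{ℂ_p}`
  obtain ⟨J₀, hJ₀⟩ := exists_ringHom_unrIntegers_padicComplexInt (p := p)
  -- (iii) CGS Prop. 2.4.5 / YZ Prop. 3.14: `(G⁻) = (L_p^BDP)` in `𝒪_{ℂ_p}⟦T⟧`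
  have hspan : Ideal.span {minus G} = Ideal.span {PowerSeries.map J₀ L} :=
    h314 ι W K v vbar κ₁ κ₂ γ₁ γ₂ hf hS hHeeg Ω δ Ωp LK G hLK hG ΩK Ωp' L hΩK hBDP J₀ hJ₀
  -- (iv) transport the unit coefficient
  exact HasUnitContent.of_span_singleton_eq hspan (HasUnitContent.map J₀ ⟨k, hk⟩)

/-- **BCS 2025, Prop. 4.2.2, `L_p^Gr` half: `μ(L_p^Gr(E/K)) = 0`** in the two-variable sense — granted
the two named facts and under the same hypotheses, some coefficient `[T₁⁰ T₂ʲ] G` of the Greenberg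
series `G ∈ 𝒪_{ℂ_p}⟦T₁⟧⟦T₂⟧` is a unit of `𝒪_{ℂ_p}` (so `G ∉ 𝔪·𝒪_{ℂ_p}⟦T₁,T₂⟧`).
[cite: BurungaleCastellaSkinner2025, Prop. 4.2.2 (§4.2, pp. 8–9 of arXiv:2405.00270v2)]
[cite: YanZhu2024MainConjNonCM, Prop. 3.14 (arXiv:2412.20078v4 TeX l.896–903)] -/
theorem exists_isUnit_coeff_coeff_of_prop314_of_prop422 (h314 : prop314_span_minus_eq_span_bdp)
    (h422 : prop422_exists_isBDPLFunction_mu_eq_zero) (ι : PadicAlgCl p ≃+* ℂ)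
    (W : WeierstrassCurve ℚ) [W.IsElliptic] [W.IsGloballyMinimal] (K : Type) [Field K] [NumberField K]
    (v vbar : HeightOneSpectrum (𝓞 K)) (κ₁ κ₂ : ZpExtension K p) (γ₁ γ₂ : absoluteGaloisGroup K)
    [Fact (ZpExtension.IsTopGeneratorPair κ₁ κ₂ γ₁ γ₂)] {N : ℕ} [NeZero N]
    {f : CuspForm (Gamma0 N) 2} (hf : IsNewformOf W f) [NeZero (NumberField.discr K).natAbs]
    (hS : GreenbergSetting ι W N K v vbar κ₁ κ₂) (hHeeg : SatisfiesHeegnerHypothesis N K)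
    (hirrK : (W.baseChange K).HasIrreducibleModPGaloisRep p) {Ω δ : ℂ} {Ωp : (unrIntegers p)ˣ}
    {LK G : PowerSeries (PowerSeries (PadicComplexInt p))}
    (hLK : IsKatzMeasure₂ ι v vbar ∅ κ₁ κ₂ γ₁⁻¹ γ₂⁻¹ 1 Ω δ ((Ωp : unrIntegers p) : ℂ_[p]) LK)
    (hG : IsGreenbergLFunction₂ ι v vbar κ₁ κ₂ γ₁⁻¹ γ₂⁻¹ f (NumberField.discr K).natAbs
      (NumberField.classNumber K) LK G) :
    ∃ j : ℕ, IsUnit (PowerSeries.coeff j (PowerSeries.coeff 0 G)) := by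
  obtain ⟨j, hj⟩ := hasUnitContent_minus_of_prop314_of_prop422 h314 h422 ι W K v vbar κ₁ κ₂ γ₁ γ₂ hf
    hS hHeeg hirrK hLK hG
  exact ⟨j, by rwa [coeff_minus] at hj⟩

/-- **Both halves of BCS Prop. 4.2.2 at once** (granted the three named facts that feed them:
existence of the Greenberg frame `thm39_def311_…`, the comparison `prop314_…`, and the BDP half
`prop422_…`): under the hypotheses above there ARE a Katz/Greenberg frame `(LK, G)` with `μ(G⁻) = 0`
and a BDP frame `L` (at `γ₂⁻¹`) with `μ(L) = 0`.
[cite: BurungaleCastellaSkinner2025, Prop. 4.2.2 (§4.2, pp. 8–9 of arXiv:2405.00270v2)]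
[cite: YanZhu2024MainConjNonCM, Def. 3.11, Prop. 3.14 (arXiv:2412.20078v4 TeX l.865–903)] -/
theorem prop422_both_of_thm39_of_prop314_of_prop422 (h39 : thm39_def311_exists_isGreenbergLFunction₂)
    (h314 : prop314_span_minus_eq_span_bdp) (h422 : prop422_exists_isBDPLFunction_mu_eq_zero)
    (ι : PadicAlgCl p ≃+* ℂ) (W : WeierstrassCurve ℚ) [W.IsElliptic] [W.IsGloballyMinimal]
    (K : Type) [Field K] [NumberField K] (v vbar : HeightOneSpectrum (𝓞 K))
    (κ₁ κ₂ : ZpExtension K p) (γ₁ γ₂ : absoluteGaloisGroup K)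
    [Fact (ZpExtension.IsTopGeneratorPair κ₁ κ₂ γ₁ γ₂)] {N : ℕ} [NeZero N]
    {f : CuspForm (Gamma0 N) 2} (hf : IsNewformOf W f) [NeZero (NumberField.discr K).natAbs]
    (hS : GreenbergSetting ι W N K v vbar κ₁ κ₂) (hHeeg : SatisfiesHeegnerHypothesis N K)
    (hirrK : (W.baseChange K).HasIrreducibleModPGaloisRep p) :
    (∃ (Ω δ : ℂ) (Ωp : (unrIntegers p)ˣ) (LK G : PowerSeries (PowerSeries (PadicComplexInt p))),
        IsKatzMeasure₂ ι v vbar ∅ κ₁ κ₂ γ₁⁻¹ γ₂⁻¹ 1 Ω δ ((Ωp : unrIntegers p) : ℂ_[p]) LK ∧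
        IsGreenbergLFunction₂ ι v vbar κ₁ κ₂ γ₁⁻¹ γ₂⁻¹ f (NumberField.discr K).natAbs
          (NumberField.classNumber K) LK G ∧ HasUnitContent (minus G)) ∧
      ∃ (ΩK : ℂ) (Ωp' : (unrIntegers p)ˣ) (L : UnrSeries p), ΩK ≠ 0 ∧
        IsBDPLFunction ι v κ₂ γ₂⁻¹ f ΩK ((Ωp' : unrIntegers p) : ℂ_[p]) L ∧ HasUnitContent L := by
  have hpair : ZpExtension.IsTopGeneratorPair κ₁ κ₂ γ₁ γ₂ := Fact.out
  refine ⟨?_, ?_⟩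
  · obtain ⟨Ω, δ, Ωp, LK, G, -, -, hLK, hG⟩ := h39 ι W K v vbar κ₁ κ₂ γ₁ γ₂ hf hS
    exact ⟨Ω, δ, Ωp, LK, G, hLK, hG, hasUnitContent_minus_of_prop314_of_prop422 h314 h422 ι W K v vbar
      κ₁ κ₂ γ₁ γ₂ hf hS hHeeg hirrK hLK hG⟩
  · obtain ⟨ΩK, Ωp', L, hΩK, hBDP', k, hk⟩ := h422 ι W K v (κ₂.unitTwist (-1)) γ₂⁻¹ hf
      (by have := hS.three_le; omega) hS.goodOrd.1 hS.isImaginaryQuadratic hHeeg hS.split hS.discr_odd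
      hS.discr_ne hirrK hS.mem_v hS.compat (ZpExtension.isAnticyclotomic_unitTwist hS.anticyclotomic _)
      (ZpExtension.isTopGenerator_unitTwist_neg_one_inv hpair.right)
    exact ⟨ΩK, Ωp', L, hΩK, (isBDPLFunction_unitTwist_iff ι v κ₂ (-1) γ₂⁻¹ f ΩK _ L).mp hBDP', k, hk⟩


/-! ## §D. Proposition 4.2.2, the `L_p^Gr` half, over the SOUND value frame — PROVED from the
superseding named facts (`…AnyRoot`) -/

/-- **BCS 2025, Prop. 4.2.2, `L_p^Gr` half, anticyclotomic projection: `μ(L_p^Gr(E/K)⁻) = 0`, in the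
sound value frame** — the printed proof replayed over the superseding facts: "By [Hsi14, Thm. B],
`L_p^BDP(g/K)` has vanishing `μ`-invariant [`prop422_exists_isBDPLFunction_mu_eq_zero`, frame at the
plain generator `γ₂`]. Since … the projection of `L_p^Gr(g/K)` to `Λ_K^{−,ur}` generates the same ideal
as `L_p^BDP(g/K)` [`YanZhu2026.prop314_span_minus_eq_span_bdp_anyRoot` = CGS Prop. 2.4.5], the result
follows."  Granted those two named facts: for `E = W/ℚ` elliptic and globally minimal with newform `f`,
under `GreenbergSetting ι W N K 𝔭 𝔭̄ κ₁ κ₂`, (Heeg) and (irr_K), EVERY Katz/Greenberg frame `(LK, G)`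
read at `(γ₁⁻¹, γ₂⁻¹)` with `G` in `IsGreenbergLFunctionAnyRoot₂` has `HasUnitContent (G⁻)`.  WEAKER
than print (ordinary `p` through `GreenbergSetting`; `f = f_E`).
[cite: BurungaleCastellaSkinner2025, Prop. 4.2.2 and its proof (§4.2, pp. 8–9 of arXiv:2405.00270v2)]
[cite: YanZhu2024MainConjNonCM, Prop. 3.14 (arXiv:2412.20078v4 TeX l.896–903)] [cite: Hsieh2014, Thm. B] -/
theorem hasUnitContent_minus_of_prop314AnyRoot_of_prop422
    (h314 : prop314_span_minus_eq_span_bdp_anyRoot) (h422 : prop422_exists_isBDPLFunction_mu_eq_zero)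
    (ι : PadicAlgCl p ≃+* ℂ) (W : WeierstrassCurve ℚ) [W.IsElliptic] [W.IsGloballyMinimal] (K : Type)
    [Field K] [NumberField K] (v vbar : HeightOneSpectrum (𝓞 K)) (κ₁ κ₂ : ZpExtension K p)
    (γ₁ γ₂ : absoluteGaloisGroup K) [hpair : Fact (ZpExtension.IsTopGeneratorPair κ₁ κ₂ γ₁ γ₂)]
    {N : ℕ} [NeZero N] {f : CuspForm (Gamma0 N) 2} (hf : IsNewformOf W f)
    [NeZero (NumberField.discr K).natAbs] (hS : GreenbergSetting ι W N K v vbar κ₁ κ₂)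
    (hHeeg : SatisfiesHeegnerHypothesis N K) (hirrK : (W.baseChange K).HasIrreducibleModPGaloisRep p)
    {Ω δ : ℂ} {Ωp : (unrIntegers p)ˣ} {LK G : PowerSeries (PowerSeries (PadicComplexInt p))}
    (hLK : IsKatzMeasure₂ ι v vbar ∅ κ₁ κ₂ γ₁⁻¹ γ₂⁻¹ 1 Ω δ ((Ωp : unrIntegers p) : ℂ_[p]) LK)
    (hG : IsGreenbergLFunctionAnyRoot₂ ι v vbar κ₁ κ₂ γ₁⁻¹ γ₂⁻¹ f (NumberField.discr K).natAbs
      (NumberField.classNumber K) LK G) :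
    HasUnitContent (minus G) := by
  -- (i) Hsieh's `μ(L_p^BDP) = 0` frame at the plain anticyclotomic generator `γ₂`
  obtain ⟨ΩK, Ωp', L, hΩK, hBDP, k, hk⟩ := h422 ι W K v κ₂ γ₂ hf (by have := hS.three_le; omega)
    hS.goodOrd.1 hS.isImaginaryQuadratic hHeeg hS.split hS.discr_odd hS.discr_ne hirrK hS.mem_v
    hS.compat hS.anticyclotomic hpair.out.right
  -- (ii) the structure map `J₀ : R₀ → 𝒪_{ℂ_p}`
  obtain ⟨J₀, hJ₀⟩ := exists_ringHom_unrIntegers_padicComplexInt (p := p)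
  -- (iii) CGS Prop. 2.4.5 / YZ Prop. 3.14 over the sound frame: `(G⁻) = (L_p^BDP)` in `𝒪_{ℂ_p}⟦T⟧`
  have hspan : Ideal.span {minus G} = Ideal.span {PowerSeries.map J₀ L} :=
    h314 ι W K v vbar κ₁ κ₂ γ₁ γ₂ hf hS hHeeg Ω δ Ωp LK G hLK hG ΩK Ωp' L hΩK hBDP J₀ hJ₀
  -- (iv) transport the unit coefficient
  exact HasUnitContent.of_span_singleton_eq hspan (HasUnitContent.map J₀ ⟨k, hk⟩)

/-- **BCS 2025, Prop. 4.2.2, `L_p^Gr` half: `μ(L_p^Gr(E/K)) = 0`** in the two-variable sense, sound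
frame — granted the two named facts and under the same hypotheses, some coefficient `[T₁⁰ T₂ʲ] G` of
the Greenberg series `G ∈ 𝒪_{ℂ_p}⟦T₁⟧⟦T₂⟧` is a unit of `𝒪_{ℂ_p}`.
[cite: BurungaleCastellaSkinner2025, Prop. 4.2.2 (§4.2, pp. 8–9 of arXiv:2405.00270v2)]
[cite: YanZhu2024MainConjNonCM, Prop. 3.14 (arXiv:2412.20078v4 TeX l.896–903)] -/
theorem exists_isUnit_coeff_coeff_of_prop314AnyRoot_of_prop422
    (h314 : prop314_span_minus_eq_span_bdp_anyRoot) (h422 : prop422_exists_isBDPLFunction_mu_eq_zero)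
    (ι : PadicAlgCl p ≃+* ℂ) (W : WeierstrassCurve ℚ) [W.IsElliptic] [W.IsGloballyMinimal] (K : Type)
    [Field K] [NumberField K] (v vbar : HeightOneSpectrum (𝓞 K)) (κ₁ κ₂ : ZpExtension K p)
    (γ₁ γ₂ : absoluteGaloisGroup K) [Fact (ZpExtension.IsTopGeneratorPair κ₁ κ₂ γ₁ γ₂)]
    {N : ℕ} [NeZero N] {f : CuspForm (Gamma0 N) 2} (hf : IsNewformOf W f)
    [NeZero (NumberField.discr K).natAbs] (hS : GreenbergSetting ι W N K v vbar κ₁ κ₂)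
    (hHeeg : SatisfiesHeegnerHypothesis N K) (hirrK : (W.baseChange K).HasIrreducibleModPGaloisRep p)
    {Ω δ : ℂ} {Ωp : (unrIntegers p)ˣ} {LK G : PowerSeries (PowerSeries (PadicComplexInt p))}
    (hLK : IsKatzMeasure₂ ι v vbar ∅ κ₁ κ₂ γ₁⁻¹ γ₂⁻¹ 1 Ω δ ((Ωp : unrIntegers p) : ℂ_[p]) LK)
    (hG : IsGreenbergLFunctionAnyRoot₂ ι v vbar κ₁ κ₂ γ₁⁻¹ γ₂⁻¹ f (NumberField.discr K).natAbs
      (NumberField.classNumber K) LK G) :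
    ∃ j : ℕ, IsUnit (PowerSeries.coeff j (PowerSeries.coeff 0 G)) := by
  obtain ⟨j, hj⟩ := hasUnitContent_minus_of_prop314AnyRoot_of_prop422 h314 h422 ι W K v vbar κ₁ κ₂
    γ₁ γ₂ hf hS hHeeg hirrK hLK hG
  exact ⟨j, by rwa [coeff_minus] at hj⟩

/-- **Both halves of BCS Prop. 4.2.2 at once, sound frame** (granted the three named facts that feed
them: existence of the Greenberg frame `thm39_def311_…AnyRoot₂`, the comparison `prop314_…_anyRoot`,
and the BDP half `prop422_…`): under the hypotheses above there ARE a Katz/Greenberg frame `(LK, G)`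
with `μ(G⁻) = 0` and a BDP frame `L` at `γ₂` with `μ(L) = 0`.
[cite: BurungaleCastellaSkinner2025, Prop. 4.2.2 (§4.2, pp. 8–9 of arXiv:2405.00270v2)]
[cite: YanZhu2024MainConjNonCM, Def. 3.11, Prop. 3.14 (arXiv:2412.20078v4 TeX l.865–903)] -/
theorem prop422_both_of_thm39AnyRoot_of_prop314AnyRoot_of_prop422
    (h39 : thm39_def311_exists_isGreenbergLFunctionAnyRoot₂)
    (h314 : prop314_span_minus_eq_span_bdp_anyRoot) (h422 : prop422_exists_isBDPLFunction_mu_eq_zero)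
    (ι : PadicAlgCl p ≃+* ℂ) (W : WeierstrassCurve ℚ) [W.IsElliptic] [W.IsGloballyMinimal]
    (K : Type) [Field K] [NumberField K] (v vbar : HeightOneSpectrum (𝓞 K))
    (κ₁ κ₂ : ZpExtension K p) (γ₁ γ₂ : absoluteGaloisGroup K)
    [hpair : Fact (ZpExtension.IsTopGeneratorPair κ₁ κ₂ γ₁ γ₂)] {N : ℕ} [NeZero N]
    {f : CuspForm (Gamma0 N) 2} (hf : IsNewformOf W f) [NeZero (NumberField.discr K).natAbs]
    (hS : GreenbergSetting ι W N K v vbar κ₁ κ₂) (hHeeg : SatisfiesHeegnerHypothesis N K)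
    (hirrK : (W.baseChange K).HasIrreducibleModPGaloisRep p) :
    (∃ (Ω δ : ℂ) (Ωp : (unrIntegers p)ˣ) (LK G : PowerSeries (PowerSeries (PadicComplexInt p))),
        IsKatzMeasure₂ ι v vbar ∅ κ₁ κ₂ γ₁⁻¹ γ₂⁻¹ 1 Ω δ ((Ωp : unrIntegers p) : ℂ_[p]) LK ∧
        IsGreenbergLFunctionAnyRoot₂ ι v vbar κ₁ κ₂ γ₁⁻¹ γ₂⁻¹ f (NumberField.discr K).natAbs
          (NumberField.classNumber K) LK G ∧ HasUnitContent (minus G)) ∧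
      ∃ (ΩK : ℂ) (Ωp' : (unrIntegers p)ˣ) (L : UnrSeries p), ΩK ≠ 0 ∧
        IsBDPLFunction ι v κ₂ γ₂ f ΩK ((Ωp' : unrIntegers p) : ℂ_[p]) L ∧ HasUnitContent L := by
  refine ⟨?_, ?_⟩
  · obtain ⟨Ω, δ, Ωp, LK, G, -, -, hLK, hG⟩ := h39 ι W K v vbar κ₁ κ₂ γ₁ γ₂ hf hS
    exact ⟨Ω, δ, Ωp, LK, G, hLK, hG, hasUnitContent_minus_of_prop314AnyRoot_of_prop422 h314 h422 ι W K
      v vbar κ₁ κ₂ γ₁ γ₂ hf hS hHeeg hirrK hLK hG⟩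
  · obtain ⟨ΩK, Ωp', L, hΩK, hBDP, k, hk⟩ := h422 ι W K v κ₂ γ₂ hf (by have := hS.three_le; omega)
      hS.goodOrd.1 hS.isImaginaryQuadratic hHeeg hS.split hS.discr_odd hS.discr_ne hirrK hS.mem_v
      hS.compat hS.anticyclotomic hpair.out.right
    exact ⟨ΩK, Ωp', L, hΩK, hBDP, k, hk⟩

end Literature.NumberTheory.EllipticCurves.BurungaleCastellaSkinner2025

end
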